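import Mathlib
import Summits.NavierStokesRegularity.NavierStokesRegularity.Theorems.LevelSetModerationHighSpeedPressureWorkPressureFreeBound
import Summits.NavierStokesRegularity.NavierStokesRegularity.Theorems.LevelSetModerationHighSpeedPressureWorkFastSetGradientLogFree
import Summits.NavierStokesRegularity.NavierStokesRegularity.Theorems.LevelSetModerationHighSpeedPressureWorkSliceMeasurability

/-!
# Route LevelSetModeration — `HighSpeedPressureWork`: pressure-free anatomy of the early bookkeeping (tools)

Support file for item stmt-NavierStokesRegularity-18149 (`HighSpeedPressureWork`), line
`line-iso-speed-area-closure` (skeleton v4, lead c1): per-solution bricks for the companion file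
`…EarlyAnatomy.lean` (`EarlyBookkeeping ↔ EarlySliceLaw ∧ EarlyRotationLaw`). By the landed EXACT
level-set balance (`levelSetModeration_pressureFreeBalance`, Vasseur's Lemma 11 as an identity)

  `PW_c(t) = ½ ∫ (|u(t)| - c)₊² + ν ∫₀ᵗ∫ 1_{|u|>c} [ (c/|u|) |∇|u||² + (1 - c/|u|) |∇u|²_F ]`.

* `earlyAnatomy_indicator_density_split` / `earlyAnatomy_viscous_lintegral_eq`: the viscous density
  (and its space–time integral) splits as `|∇|u||² + (1 - c/|u|)(|∇u|²_F - |∇|u||²)` on the fast set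
  (Kato `|∇|u|| ≤ |∇u|_F`), i.e. VISCOUS TERM `= ν D_c(t) +` ROTATION TERM
  `R_c(t) = ν∫₀ᵗ∫ 1_{|u|>c}(1 - c/|u|)(|∇u|²_F - |∇|u||²)` (`= ν∫∫ 1_A (1-c/|u|)|u|²|∇û|²`);
* `earlyAnatomy_viscous_lintegral_ne_top`: the viscous term is finite (dominated by the enstrophy);
* `earlyAnatomy_terms`: `PW = U + νL`, `U ≥ 0`, `R ≤ L < ∞` for one solution;
* `earlyAnatomy_combine` & co.: algebra of moduli `(√F₁⁺ + √F₂⁺)²` and of the early window;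
* `levelSetModeration_earlyDissipation_bookkept` (registered): the dissipation part is bookkept
  UNCONDITIONALLY at margin zero, `ν D_c(t) ≤ A B₀² √(V_c(T)) √(D_c(T))` for `c ≥ B₀`,
  `t ≤ min T (εν/B₀²)` — seat 0's log-free fast-set law `ν² D_c(t) ≤ A²B₀⁴ V_c(t)`
  (`levelSetModeration_fastSetDissipation_le`) in the bilinear form of the crux.
-/

noncomputable section

-- single-conjunct summit: `Summit.<Summit>.<Problem>` repeats the name by the D-0017 layout
set_option linter.dupNamespace false

namespace Summit.NavierStokesRegularity.NavierStokesRegularity.Theorems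

open MeasureTheory Set Filter Topology Function
open scoped ENNReal
open Literature.Analysis.FluidPDE

/-! ### Pointwise algebra of the viscous density on the fast set -/

/-- On the fast set the level-set dissipation density is dominated by the Frobenius density:
`‖D|u|(x)‖² ≤ |Du(x)|²_F` for `u` differentiable at `x` with `u x ≠ 0` (Kato). [folklore] -/
theorem earlyAnatomy_sq_norm_fderiv_norm_le_frobenius
    {v : EuclideanSpace ℝ (Fin 3) → EuclideanSpace ℝ (Fin 3)} {x : EuclideanSpace ℝ (Fin 3)}
    (hv : DifferentiableAt ℝ v x) (hx : v x ≠ 0) :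
    ‖fderiv ℝ (fun y => ‖v y‖) x‖ ^ 2 ≤ frobeniusNormSq (fderiv ℝ v x) :=
  calc ‖fderiv ℝ (fun y => ‖v y‖) x‖ ^ 2 ≤ ‖fderiv ℝ v x‖ ^ 2 := by
        gcongr
        exact norm_fderiv_norm_comp_le hv hx
    _ ≤ frobeniusNormSq (fderiv ℝ v x) := sq_opNorm_le_frobeniusNormSq _

/-- The viscous density of the exact balance splits on the fast set `{c < |v|}` (`c > 0`) into the
level-set dissipation density plus the nonnegative ROTATION density:
`1_A ofReal((c/|v|)g² + (1-c/|v|)F) = 1_A ofReal(g²) + 1_A ofReal((1-c/|v|)(F - g²))`,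
`g = ‖D|v|‖`, `F = |Dv|²_F`. [folklore] -/
theorem earlyAnatomy_indicator_density_split
    {v : EuclideanSpace ℝ (Fin 3) → EuclideanSpace ℝ (Fin 3)} (hv : Differentiable ℝ v)
    {c : ℝ} (hc : 0 < c) (x : EuclideanSpace ℝ (Fin 3)) :
    Set.indicator {x | c < ‖v x‖} (fun x => ENNReal.ofReal
        (c / ‖v x‖ * ‖fderiv ℝ (fun y => ‖v y‖) x‖ ^ 2 +
          (1 - c / ‖v x‖) * frobeniusNormSq (fderiv ℝ v x))) x =
      Set.indicator {x | c < ‖v x‖}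
          (fun x => ENNReal.ofReal (‖fderiv ℝ (fun y => ‖v y‖) x‖ ^ 2)) x +
        Set.indicator {x | c < ‖v x‖} (fun x => ENNReal.ofReal
          ((1 - c / ‖v x‖) * (frobeniusNormSq (fderiv ℝ v x) -
            ‖fderiv ℝ (fun y => ‖v y‖) x‖ ^ 2))) x := by
  by_cases hx : x ∈ {x | c < ‖v x‖}
  · rw [indicator_of_mem hx, indicator_of_mem hx, indicator_of_mem hx]
    have hcx : c < ‖v x‖ := hx
    have hvx : v x ≠ 0 := by
      intro h0; rw [h0, norm_zero] at hcx; exact absurd hcx (not_lt.2 hc.le)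
    have hs : 0 < ‖v x‖ := hc.trans hcx
    have hKato := earlyAnatomy_sq_norm_fderiv_norm_le_frobenius (hv x) hvx
    have hw : 0 ≤ 1 - c / ‖v x‖ := by
      rw [sub_nonneg, div_le_one hs]; exact hcx.le
    rw [← ENNReal.ofReal_add (sq_nonneg _) (mul_nonneg hw (sub_nonneg.2 hKato))]
    congr 1
    ring
  · rw [indicator_of_notMem hx, indicator_of_notMem hx, indicator_of_notMem hx, add_zero]

/-- On the fast set the viscous density of the exact balance is dominated by the Frobenius density:
`1_A ofReal((c/|v|)g² + (1-c/|v|)F) ≤ ofReal(F)`. [folklore] -/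
theorem earlyAnatomy_indicator_density_le_frobenius
    {v : EuclideanSpace ℝ (Fin 3) → EuclideanSpace ℝ (Fin 3)} (hv : Differentiable ℝ v)
    {c : ℝ} (hc : 0 < c) (x : EuclideanSpace ℝ (Fin 3)) :
    Set.indicator {x | c < ‖v x‖} (fun x => ENNReal.ofReal
        (c / ‖v x‖ * ‖fderiv ℝ (fun y => ‖v y‖) x‖ ^ 2 +
          (1 - c / ‖v x‖) * frobeniusNormSq (fderiv ℝ v x))) x ≤
      ENNReal.ofReal (frobeniusNormSq (fderiv ℝ v x)) := by
  by_cases hx : x ∈ {x | c < ‖v x‖}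
  · rw [indicator_of_mem hx]
    have hcx : c < ‖v x‖ := hx
    have hvx : v x ≠ 0 := by
      intro h0; rw [h0, norm_zero] at hcx; exact absurd hcx (not_lt.2 hc.le)
    have hs : 0 < ‖v x‖ := hc.trans hcx
    have hKato := earlyAnatomy_sq_norm_fderiv_norm_le_frobenius (hv x) hvx
    have hw1 : c / ‖v x‖ ≤ 1 := (div_le_one hs).2 hcx.le
    have hw0 : 0 ≤ c / ‖v x‖ := div_nonneg hc.le hs.le
    refine ENNReal.ofReal_le_ofReal ?_
    nlinarith [hKato, hw1, hw0, sq_nonneg ‖fderiv ℝ (fun y => ‖v y‖) x‖]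
  · rw [indicator_of_notMem hx]
    exact bot_le

/-- The level-set dissipation slice density is measurable (any function has a measurable `fderiv`;
the fast set of a continuous field is open). [folklore] -/
theorem earlyAnatomy_measurable_dissipationDensity
    {v : EuclideanSpace ℝ (Fin 3) → EuclideanSpace ℝ (Fin 3)} (hv : Continuous v) (c : ℝ) :
    Measurable fun x => Set.indicator {x | c < ‖v x‖}
      (fun x => ENNReal.ofReal (‖fderiv ℝ (fun y => ‖v y‖) x‖ ^ 2)) x := by
  have hA : MeasurableSet {x | c < ‖v x‖} := (isOpen_lt continuous_const hv.norm).measurableSet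
  refine Measurable.indicator ?_ hA
  exact ENNReal.measurable_ofReal.comp ((measurable_fderiv ℝ (fun y => ‖v y‖)).norm.pow_const 2)

/-! ### Per solution: the viscous term splits into dissipation plus rotation, all finite -/

/-- **Split of the viscous term of the exact balance.** For a classical solution on `[0,T)`,
`c > 0`, `t ≤ T`:
`∫₀ᵗ∫ 1_A[(c/|u|)|∇|u||² + (1-c/|u|)|∇u|²_F] = D_c(t) + ∫₀ᵗ∫ 1_A (1-c/|u|)(|∇u|²_F - |∇|u||²)`
(pointwise split `earlyAnatomy_indicator_density_split`; additivity of the Lebesgue integral via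
the measurability of the dissipation slice, `levelSetModeration_aemeasurable_dissipationSlice`).
[folklore] -/
theorem earlyAnatomy_viscous_lintegral_eq {ν T : ℝ}
    {u : ℝ → EuclideanSpace ℝ (Fin 3) → EuclideanSpace ℝ (Fin 3)}
    {p : ℝ → EuclideanSpace ℝ (Fin 3) → ℝ} (hcl : IsClassicalNSSolutionOn (Ico 0 T) ν 0 u p)
    {c : ℝ} (hc : 0 < c) {t : ℝ} (htT : t ≤ T) :
    (∫⁻ τ in Ioo 0 t, ∫⁻ x, {x | c < ‖u τ x‖}.indicator (fun x => ENNReal.ofReal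
        (c / ‖u τ x‖ * ‖fderiv ℝ (fun y => ‖u τ y‖) x‖ ^ 2 +
          (1 - c / ‖u τ x‖) * frobeniusNormSq (fderiv ℝ (u τ) x))) x) =
      (∫⁻ τ in Ioo 0 t, ∫⁻ x, {x | c < ‖u τ x‖}.indicator
          (fun x => ENNReal.ofReal (‖fderiv ℝ (fun y => ‖u τ y‖) x‖ ^ 2)) x) +
        ∫⁻ τ in Ioo 0 t, ∫⁻ x, {x | c < ‖u τ x‖}.indicator (fun x => ENNReal.ofReal
          ((1 - c / ‖u τ x‖) * (frobeniusNormSq (fderiv ℝ (u τ) x) -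
            ‖fderiv ℝ (fun y => ‖u τ y‖) x‖ ^ 2))) x := by
  have hDs := levelSetModeration_aemeasurable_dissipationSlice hcl.smooth_velocity hc htT
  rw [← lintegral_add_left' hDs]
  refine setLIntegral_congr_fun measurableSet_Ioo fun τ hτ => ?_
  have hτ' : τ ∈ Ico 0 T := ⟨hτ.1.le, hτ.2.trans_le htT⟩
  have hdiff : Differentiable ℝ (u τ) := (hcl.contDiff_velocity hτ').differentiable (by simp)
  have hcont : Continuous (u τ) := hdiff.continuous
  show (∫⁻ x, {x | c < ‖u τ x‖}.indicator (fun x => ENNReal.ofReal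
        (c / ‖u τ x‖ * ‖fderiv ℝ (fun y => ‖u τ y‖) x‖ ^ 2 +
          (1 - c / ‖u τ x‖) * frobeniusNormSq (fderiv ℝ (u τ) x))) x) =
      (∫⁻ x, {x | c < ‖u τ x‖}.indicator
          (fun x => ENNReal.ofReal (‖fderiv ℝ (fun y => ‖u τ y‖) x‖ ^ 2)) x) +
        ∫⁻ x, {x | c < ‖u τ x‖}.indicator (fun x => ENNReal.ofReal
          ((1 - c / ‖u τ x‖) * (frobeniusNormSq (fderiv ℝ (u τ) x) -
            ‖fderiv ℝ (fun y => ‖u τ y‖) x‖ ^ 2))) x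
  rw [← lintegral_add_left (earlyAnatomy_measurable_dissipationDensity hcont c)]
  exact lintegral_congr fun x => earlyAnatomy_indicator_density_split hdiff hc x

/-- **The viscous term of the exact balance is finite** for a classical solution which is
Leray–Hopf on `[0,T]`: its density is dominated by `|∇u|²_F`, whose space–time integral is
bounded by the initial energy (`IsLerayHopfOn.lintegral_frobeniusNormSq_fderiv_of_classical`).
[folklore] -/
theorem earlyAnatomy_viscous_lintegral_ne_top {ν T : ℝ}
    {u : ℝ → EuclideanSpace ℝ (Fin 3) → EuclideanSpace ℝ (Fin 3)}
    {p : ℝ → EuclideanSpace ℝ (Fin 3) → ℝ} (hcl : IsClassicalNSSolutionOn (Ico 0 T) ν 0 u p)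
    (hLH : IsLerayHopfOn T ν 0 (u 0) u) (hT : 0 < T) {c : ℝ} (hc : 0 < c) {t : ℝ} (htT : t ≤ T) :
    (∫⁻ τ in Ioo 0 t, ∫⁻ x, {x | c < ‖u τ x‖}.indicator (fun x => ENNReal.ofReal
        (c / ‖u τ x‖ * ‖fderiv ℝ (fun y => ‖u τ y‖) x‖ ^ 2 +
          (1 - c / ‖u τ x‖) * frobeniusNormSq (fderiv ℝ (u τ) x))) x) ≠ ⊤ := by
  obtain ⟨hfin, -⟩ := IsLerayHopfOn.lintegral_frobeniusNormSq_fderiv_of_classical hcl hLH hT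
  refine ne_top_of_le_ne_top hfin ?_
  calc (∫⁻ τ in Ioo 0 t, ∫⁻ x, {x | c < ‖u τ x‖}.indicator (fun x => ENNReal.ofReal
        (c / ‖u τ x‖ * ‖fderiv ℝ (fun y => ‖u τ y‖) x‖ ^ 2 +
          (1 - c / ‖u τ x‖) * frobeniusNormSq (fderiv ℝ (u τ) x))) x)
      ≤ ∫⁻ τ in Ioo 0 t, ∫⁻ x, ENNReal.ofReal (frobeniusNormSq (fderiv ℝ (u τ) x)) := by
        refine setLIntegral_mono' measurableSet_Ioo fun τ hτ => ?_
        have hτ' : τ ∈ Ico 0 T := ⟨hτ.1.le, hτ.2.trans_le htT⟩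
        have hdiff : Differentiable ℝ (u τ) :=
          (hcl.contDiff_velocity hτ').differentiable (by simp)
        exact lintegral_mono fun x => earlyAnatomy_indicator_density_le_frobenius hdiff hc x
    _ ≤ ∫⁻ τ in Ioo 0 T, ∫⁻ x, ENNReal.ofReal (frobeniusNormSq (fderiv ℝ (u τ) x)) :=
        lintegral_mono_set (Ioo_subset_Ioo le_rfl htT)

/-! ### Per solution: the exact balance and the order relations between its terms -/

/-- **The four terms of one solution in order.** For a classical Leray–Hopf solution from a
rapidly decaying datum, a level `c > 0` above the initial speed maximum and `t ∈ [0,T)`, writing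
`PW` (pressure work), `U = ½∫(|u(t)|-c)₊²` (slice term), `L` (viscous term of the exact balance)
and `R` (rotation term, as `ℝ≥0∞` space–time integrals): `PW = U + ν L.toReal`, `0 ≤ U`,
`R ≤ L < ∞`. [folklore] -/
theorem earlyAnatomy_terms {ν T : ℝ}
    {u : ℝ → EuclideanSpace ℝ (Fin 3) → EuclideanSpace ℝ (Fin 3)}
    {p : ℝ → EuclideanSpace ℝ (Fin 3) → ℝ} (hν : 0 < ν) (hT : 0 < T)
    (hcl : IsClassicalNSSolutionOn (Ico 0 T) ν 0 u p) (hLH : IsLerayHopfOn T ν 0 (u 0) u)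
    (hdec : HasRapidSpatialDecay (u 0)) {c : ℝ} (hc : 0 < c) (hcB : ∀ x, ‖u 0 x‖ ≤ c)
    {t : ℝ} (ht : t ∈ Ico 0 T) :
    -(∫ τ in Ioo 0 t, ∫ x, max (1 - c / ‖u τ x‖) 0 *
        (fderiv ℝ (normalisedPressure (u τ)) x (u τ x))) =
      1 / 2 * (∫ x, (max (‖u t x‖ - c) 0) ^ 2) +
        ν * (∫⁻ τ in Ioo 0 t, ∫⁻ x, {x | c < ‖u τ x‖}.indicator (fun x => ENNReal.ofReal
          (c / ‖u τ x‖ * ‖fderiv ℝ (fun y => ‖u τ y‖) x‖ ^ 2 +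
            (1 - c / ‖u τ x‖) * frobeniusNormSq (fderiv ℝ (u τ) x))) x).toReal ∧
      0 ≤ 1 / 2 * (∫ x, (max (‖u t x‖ - c) 0) ^ 2) ∧
      (∫⁻ τ in Ioo 0 t, ∫⁻ x, {x | c < ‖u τ x‖}.indicator (fun x => ENNReal.ofReal
          ((1 - c / ‖u τ x‖) * (frobeniusNormSq (fderiv ℝ (u τ) x) -
            ‖fderiv ℝ (fun y => ‖u τ y‖) x‖ ^ 2))) x) ≤
        (∫⁻ τ in Ioo 0 t, ∫⁻ x, {x | c < ‖u τ x‖}.indicator (fun x => ENNReal.ofReal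
          (c / ‖u τ x‖ * ‖fderiv ℝ (fun y => ‖u τ y‖) x‖ ^ 2 +
            (1 - c / ‖u τ x‖) * frobeniusNormSq (fderiv ℝ (u τ) x))) x) ∧
      (∫⁻ τ in Ioo 0 t, ∫⁻ x, {x | c < ‖u τ x‖}.indicator (fun x => ENNReal.ofReal
          (c / ‖u τ x‖ * ‖fderiv ℝ (fun y => ‖u τ y‖) x‖ ^ 2 +
            (1 - c / ‖u τ x‖) * frobeniusNormSq (fderiv ℝ (u τ) x))) x) ≠ ⊤ := by
  refine ⟨levelSetModeration_pressureFreeBalance ν T u p hν hT hcl hLH hdec c hc hcB t ht,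
    by positivity, ?_, earlyAnatomy_viscous_lintegral_ne_top hcl hLH hT hc ht.2.le⟩
  rw [earlyAnatomy_viscous_lintegral_eq hcl hc ht.2.le]
  exact le_add_self

/-! ### Algebra of moduli and of the early window -/

/-- Two bounds of the shape `√(Fᵢ V) √D` add up to one of the same shape with modulus
`(√F₁⁺ + √F₂⁺)²`. [folklore] -/
theorem earlyAnatomy_combine {a b F₁ F₂ V D : ℝ} (hV : 0 ≤ V)
    (ha : a ≤ Real.sqrt (F₁ * V) * Real.sqrt D) (hb : b ≤ Real.sqrt (F₂ * V) * Real.sqrt D) :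
    a + b ≤ Real.sqrt ((Real.sqrt (max F₁ 0) + Real.sqrt (max F₂ 0)) ^ 2 * V) * Real.sqrt D := by
  have hpiece : ∀ Fi : ℝ, Real.sqrt (Fi * V) * Real.sqrt D ≤
      Real.sqrt (max Fi 0) * (Real.sqrt V * Real.sqrt D) := by
    intro Fi
    rw [← mul_assoc, ← Real.sqrt_mul (le_max_right _ _)]
    exact mul_le_mul_of_nonneg_right (Real.sqrt_le_sqrt
      (mul_le_mul_of_nonneg_right (le_max_left _ _) hV)) (Real.sqrt_nonneg _)
  have htarget : Real.sqrt ((Real.sqrt (max F₁ 0) + Real.sqrt (max F₂ 0)) ^ 2 * V) * Real.sqrt D =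
      Real.sqrt (max F₁ 0) * (Real.sqrt V * Real.sqrt D) +
        Real.sqrt (max F₂ 0) * (Real.sqrt V * Real.sqrt D) := by
    rw [Real.sqrt_mul (sq_nonneg _), Real.sqrt_sq (by positivity)]; ring
  rw [htarget]
  linarith [hpiece F₁, hpiece F₂]

/-- A bound of the shape `K √V √D` with `K ≥ 0` is one of the shape `√(K² V) √D`. [folklore] -/
theorem earlyAnatomy_const_mul_sqrt {K V D : ℝ} (hK : 0 ≤ K) :
    K * Real.sqrt V * Real.sqrt D = Real.sqrt (K ^ 2 * V) * Real.sqrt D := by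
  rw [Real.sqrt_mul (sq_nonneg K), Real.sqrt_sq hK]

/-- The early window of the smaller constant is contained in both windows. [folklore] -/
theorem earlyAnatomy_window_min {c₁ c₂ ν B₀ t : ℝ} (hν : 0 ≤ ν)
    (h : t ≤ min c₁ c₂ * ν / B₀ ^ 2) : t ≤ c₁ * ν / B₀ ^ 2 ∧ t ≤ c₂ * ν / B₀ ^ 2 :=
  ⟨h.trans (div_le_div_of_nonneg_right (mul_le_mul_of_nonneg_right (min_le_left _ _) hν)
      (sq_nonneg _)),
    h.trans (div_le_div_of_nonneg_right (mul_le_mul_of_nonneg_right (min_le_right _ _) hν)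
      (sq_nonneg _))⟩

/-- At a nonpositive datum bound the early window is the single instant `t = 0`
(`B₀ = 0`, and `cₑν/0 = 0` by the field convention). [folklore] -/
theorem earlyAnatomy_eq_zero_of_nonpos {u : ℝ → EuclideanSpace ℝ (Fin 3) → EuclideanSpace ℝ (Fin 3)}
    {B₀ cₑ ν T t : ℝ} (hB : B₀ ≤ 0) (hB0 : ∀ x, ‖u 0 x‖ ≤ B₀) (ht : t ∈ Ico 0 T)
    (htw : t ≤ cₑ * ν / B₀ ^ 2) : t = 0 := by
  have hB00 : B₀ = 0 := le_antisymm hB ((norm_nonneg _).trans (hB0 0))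
  rw [hB00, sq, mul_zero, div_zero] at htw
  exact le_antisymm htw ht.1

/-- Over the empty time window every `ℝ≥0∞` space–time functional vanishes. [folklore] -/
theorem earlyAnatomy_lintegral_Ioo_self (g : ℝ → ℝ≥0∞) : (∫⁻ τ in Ioo (0 : ℝ) 0, g τ) = 0 := by
  rw [Ioo_self, Measure.restrict_empty, lintegral_zero_measure]

/-- **The dissipation part of the viscous term, at margin zero, is bookkept unconditionally**:
with the absolute constants `A, ε` of `levelSetModeration_fastSetDissipation_le`, for every member
of the data class with `|u₀| ≤ B₀`, `B₀ > 0`, every level `c ≥ B₀` and every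
`t ≤ min T (εν/B₀²)`: `ν D_c(t) ≤ A B₀² √(V_c(T)) √(D_c(T))`
(`ν² D_c(t) ≤ A²B₀⁴ V_c(t)`, so `ν D_c(t) = √(ν²D_c(t)) √(D_c(t)) ≤ A B₀² √(V_c(t)) √(D_c(t))`, and
both functionals are monotone in the horizon). [folklore] -/
theorem levelSetModeration_earlyDissipation_bookkept :
    ∃ A ε : ℝ, 0 ≤ A ∧ 0 < ε ∧ ∀ (ν T : ℝ) (u : ℝ → EuclideanSpace ℝ (Fin 3) → EuclideanSpace ℝ (Fin 3)) (p : ℝ → EuclideanSpace ℝ (Fin 3) → ℝ), 0 < ν → 0 < T → Literature.Analysis.FluidPDE.IsClassicalNSSolutionOn (Set.Ico 0 T) ν 0 u p → Literature.Analysis.FluidPDE.IsLerayHopfOn T ν 0 (u 0) u → Literature.Analysis.FluidPDE.HasRapidSpatialDecay (u 0) → ∀ B₀ : ℝ, 0 < B₀ → (∀ x, ‖u 0 x‖ ≤ B₀) → ∀ (c t : ℝ), B₀ ≤ c → t ≤ T → t ≤ ε * ν / B₀ ^ 2 → ν * (∫⁻ τ in Set.Ioo 0 t, ∫⁻ x,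 Set.indicator {x | c < ‖u τ x‖} (fun x => ENNReal.ofReal (‖fderiv ℝ (fun y => ‖u τ y‖) x‖ ^ 2)) x).toReal ≤ A * B₀ ^ 2 * Real.sqrt (∫⁻ τ in Set.Ioo 0 T, MeasureTheory.volume {x | c < ‖u τ x‖}).toReal * Real.sqrt (∫⁻ τ in Set.Ioo 0 T, ∫⁻ x, Set.indicator {x | c < ‖u τ x‖} (fun x => ENNReal.ofReal (‖fderiv ℝ (fun y => ‖u τ y‖) x‖ ^ 2)) x).toReal := by
  obtain ⟨A, ε, hA0, hε, hlaw⟩ := levelSetModeration_fastSetDissipation_le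
  refine ⟨A, ε, hA0, hε, ?_⟩
  intro ν T u p hν hT hcl hLH hdec B₀ hB₀ hbd c t hc htT htε
  have hc0 : 0 < c := hB₀.trans_le hc
  -- names
  set Dt : ℝ≥0∞ := ∫⁻ τ in Ioo 0 t, ∫⁻ x, {x | c < ‖u τ x‖}.indicator
    (fun x => ENNReal.ofReal (‖fderiv ℝ (fun y => ‖u τ y‖) x‖ ^ 2)) x with hDt
  set DT : ℝ≥0∞ := ∫⁻ τ in Ioo 0 T, ∫⁻ x, {x | c < ‖u τ x‖}.indicator
    (fun x => ENNReal.ofReal (‖fderiv ℝ (fun y => ‖u τ y‖) x‖ ^ 2)) x with hDT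
  set Vt : ℝ≥0∞ := ∫⁻ τ in Ioo 0 t, volume {x | c < ‖u τ x‖} with hVt
  set VT : ℝ≥0∞ := ∫⁻ τ in Ioo 0 T, volume {x | c < ‖u τ x‖} with hVT
  set K : ℝ := A * (B₀ ^ 2 / ν) with hK
  have hK0 : 0 ≤ K := by rw [hK]; positivity
  have hsub : Ioo 0 t ⊆ Ioo 0 T := Ioo_subset_Ioo le_rfl htT
  have hDle : Dt ≤ DT := lintegral_mono_set hsub
  have hVle : Vt ≤ VT := lintegral_mono_set hsub
  have hVTfin : VT ≠ ⊤ :=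
    ne_top_of_le_ne_top ENNReal.ofReal_ne_top (levelSetVolume_le hLH hν.le hT.le hc0)
  have hDTfin : DT ≠ ⊤ := (levelSetDissipation_ne_top hcl hLH hT hν.le hc0.le).1
  have hVtfin : Vt ≠ ⊤ := ne_top_of_le_ne_top hVTfin hVle
  have hDtfin : Dt ≠ ⊤ := ne_top_of_le_ne_top hDTfin hDle
  -- the law in real form: `Dt ≤ K² Vt`
  have hlawE : Dt ≤ ENNReal.ofReal (K ^ 2) * Vt := hlaw ν T u p hν hT hcl hLH hdec B₀ hB₀ hbd c t hc htT htε
  have hlawR : Dt.toReal ≤ K ^ 2 * Vt.toReal := by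
    have h := ENNReal.toReal_mono (ENNReal.mul_ne_top ENNReal.ofReal_ne_top hVtfin) hlawE
    rwa [ENNReal.toReal_mul, ENNReal.toReal_ofReal (sq_nonneg K)] at h
  have hDreal : Dt.toReal ≤ DT.toReal := ENNReal.toReal_mono hDTfin hDle
  have hVreal : Vt.toReal ≤ VT.toReal := ENNReal.toReal_mono hVTfin hVle
  have hD0 : 0 ≤ Dt.toReal := ENNReal.toReal_nonneg
  -- `ν Dt = √(ν² Dt) √Dt ≤ ν K √Vt √Dt = A B₀² √Vt √Dt ≤ A B₀² √VT √DT`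
  have h1 : Dt.toReal = Real.sqrt Dt.toReal * Real.sqrt Dt.toReal := (Real.mul_self_sqrt hD0).symm
  have h2 : Real.sqrt Dt.toReal ≤ K * Real.sqrt Vt.toReal := by
    rw [← Real.sqrt_sq hK0, ← Real.sqrt_mul (sq_nonneg K)]
    exact Real.sqrt_le_sqrt hlawR
  have h3 : Real.sqrt Vt.toReal ≤ Real.sqrt VT.toReal := Real.sqrt_le_sqrt hVreal
  have h4 : Real.sqrt Dt.toReal ≤ Real.sqrt DT.toReal := Real.sqrt_le_sqrt hDreal
  have hνK : ν * K = A * B₀ ^ 2 := by rw [hK]; field_simp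
  show ν * Dt.toReal ≤ A * B₀ ^ 2 * Real.sqrt VT.toReal * Real.sqrt DT.toReal
  calc ν * Dt.toReal = ν * (Real.sqrt Dt.toReal * Real.sqrt Dt.toReal) := by rw [← h1]
    _ ≤ ν * ((K * Real.sqrt Vt.toReal) * Real.sqrt Dt.toReal) := by gcongr
    _ = (ν * K) * Real.sqrt Vt.toReal * Real.sqrt Dt.toReal := by ring
    _ = A * B₀ ^ 2 * Real.sqrt Vt.toReal * Real.sqrt Dt.toReal := by rw [hνK]
    _ ≤ A * B₀ ^ 2 * Real.sqrt VT.toReal * Real.sqrt DT.toReal := by gcongr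

end Summit.NavierStokesRegularity.NavierStokesRegularity.Theorems

end
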